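import Literature.AlgebraicGeometry.Resolution.ResolutionOfSingularities
import Literature.AlgebraicGeometry.Morphisms.ProjectiveAffineCoverFibreDim
import HarnessLib

/-!
# Projectivity of resolutions of the spectrum of a two-dimensional local domain
# (Lipman 1969, Corollary (27.2), p. 277 — the REGULAR special case, typed as a NAMED FACT)

Topic: `Literature/AlgebraicGeometry/Resolution` (sibling of `Lipman1969RationalContraction.lean`, whose module
docstring transcribes Corollary (27.2) verbatim and notes «not typed as a statement», l. 291).  SIGNATURE CANDIDATE
written by the INPUTS inventory planner (res-inputs-plan-1 g5, D-0154 KEY RES(1/2) item (2), TOP-10 v2 #1(a)); NOT filed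
by the planner — the typer is whoever the director keys; statement audit A1–A6 = res-inputs-crit-1.

Source, read on the page (held copy `paper:doi-10-1007-bf02684604`): J. Lipman, *Rational singularities, with
applications to algebraic surfaces and unique factorization*, Publ. Math. IHÉS 36 (1969) 195–279.
* Corollary (27.2), printed p. 277 = PDF p. 84, lines 12–14: «Let `Y` be a normal surface having only finitely many
  singular points, all of which are rational singularities. If `Y` is proper over a noetherian ring `A`, then `Y` is
  projective over `A`.»  Proof (L15–26): reduce to `Y` regular by Theorem (4.1) «arguing as in Corollary (2.5) of [3]»
  (Artin); a quadratic transformation `h` does not change projectivity of `φ` (Theorem (27.1) + uniqueness of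
  contractions); Chow's lemma [EGA II, (5.6.2)] + Theorem (26.1) (domination by a product of quadratic transformations).
* Conventions p. 199 = PDF p. 6: item 3 (regular / singular point; desingularization = proper birational with regular
  source), item 5 («surface» = reduced noetherian separated scheme of dimension two) with remark B) («if `Y` is a surface
  and `g : W → Y` is a proper birational map, then `W` is a surface»); Definition (1.1) p. 199 L33–36 (a regular
  two-dimensional local ring has a rational singularity).

WHY THE TYPED FORM IS WEAKER THAN PRINT (informal, for the critic's A1–A6): take print's `Y := X`, print's `A := A`.
`X` is a «surface»: reduced (integral), noetherian (locally Noetherian and proper — hence quasi-compact — over the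
Noetherian ring `A`), separated (proper), of dimension two (remark B) applied to `X → Spec A`, `Spec A` being a surface since
`A` is a Noetherian domain of Krull dimension `2`); `X` is regular (`IsResolution.isRegular`), hence normal with NO singular
points (so «finitely many, all rational» holds vacuously / by Def. (1.1)); `X → Spec A` is proper (`IsResolution.isProper`).
Print's conclusion «`Y` projective over `A`» in the sense of [EGA II, (5.5.2)] over the AFFINE base `Spec A` is «`Y` is
`A`-isomorphic to a closed subscheme of some `ℙⁿ_A`» = `Crystalline.IsProjectiveOverRing (Over.mk π)` (a closed
`A`-immersion into `projectiveSpaceOver n A`).  The extra hypotheses (`A` local, a domain, `= 2`; `π` birational; `X`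
integral) only weaken.  Binder-for-binder this is the hypothesis `h272` of
`Summit.…Theorems.NoZeno.gwH2ResolutionDim2_of_projectiveResolutions` (HomologicalConductorNoZenoGWH2Instance.lean, p615461)
at universe `0`, so the W4.4 consumer discharges its conjunct-6 door by `… (h : Lipman1969_27_2_regular.{0})`.

Size honesty: TYPING S; PROOF L–XL (Lipman's proof imports Thm (4.1) = FACT-LIST F-80 XL and Thm (27.1) = F-86 XL, Chow's
lemma and Thm (26.1)); an «elementary» route via an anti-ample exceptional cycle still needs a relative ampleness criterion
of EGA III (4.7.1) type.  Nothing here is proved; the W4.4 line stays conditional on this named fact exactly as it was on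
`GortzWedhorn2023_24_44_H2` before, but on a 1969 statement of the paper the slot already cites.
-/

open CategoryTheory AlgebraicGeometry

universe u

namespace Literature.AlgebraicGeometry.Resolution

/-- **Lipman 1969, Corollary (27.2) (p. 277), special case of a REGULAR surface over a two-dimensional local base**:
for `A` a Noetherian local domain of Krull dimension `2` and `π : X → Spec A` a resolution of singularities (`π` proper
and birational, `X` regular; here `X` integral and locally Noetherian), `X` is projective over `A`, i.e. `π` factors as a
closed `A`-immersion into some `ℙⁿ_A`.  Print (verbatim): «Let `Y` be a normal surface having only finitely many singular
points, all of which are rational singularities. If `Y` is proper over a noetherian ring `A`, then `Y` is projective over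
`A`.» — our `X` is such a `Y` with no singular points at all («surface» = reduced noetherian separated scheme of dimension
two, p. 199 item 5 and remark B)).  NAMED FACT (unproved here; Lipman's proof uses Thm (4.1), Thm (27.1), Chow's lemma
[EGA II, (5.6.2)] and Thm (26.1)).
[cite: Lipman1969, Corollary (27.2) (p. 277, PDF p. 84 L12–14; conventions p. 199 items 3, 5)] -/
def Lipman1969_27_2_regular : Prop :=
  ∀ (A : Type u) [CommRing A] [IsNoetherianRing A] [IsLocalRing A] [IsDomain A], ringKrullDim A = 2 →
    ∀ (X : Scheme.{u}) [IsIntegral X] [IsLocallyNoetherian X] (π : X ⟶ Spec (.of A)), IsResolution π →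
      Crystalline.IsProjectiveOverRing (Over.mk π : Motives.SchemeOver A)

end Literature.AlgebraicGeometry.Resolution
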